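import Literature.Computability.Complexity.GenericOracles
import Literature.Computability.Complexity.BakerGillSolovay
import Mathlib.Data.Set.Finite.List
import HarnessLib

/-!
# Every Cohen generic oracle separates `P` from `NP` (Fenner–Fortnow–Kurtz–Li 2003, §1; Baker–Gill–Solovay by finite extension)

Topic `Literature/Computability/Complexity`, companion of `GenericOracles.lean` (Cohen conditions,
`IsGeneric`, existence of generic oracles) and `BakerGillSolovay.lean` (the tree's proof of
`∃ B, P^B ≠ NP^B` by an explicit stage construction). Fenner–Fortnow–Kurtz–Li, *An oracle
builder's toolkit*, Inform. and Comput. 182 (2003), §1 p. 3: "The benefits of such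
simplification are well-known in several cases involving Cohen generics, where the requirements
can always be met by finite extension. For example, a minor observation regarding the
construction of an oracle separating `P` from `NP` shows that any Cohen generic oracle separates
these two classes." This file PROVES that observation in the tree's models (`PRel`, `NPRel`:
G01 transcript machines at the language oracle `Oracle.ofLanguage G`), in the form in which
genericity is rendered in the tree (a countable family of dense sets of conditions, one per
requirement):

* `BGS.DiagReq D G` — the requirement for the pair `D = (M, q)` (oracle algorithm, clock/query
  polynomial): `M` with budget `q` errs somewhere on Baker–Gill–Solovay's language
  `U_G = {x | ∃ y, |y| ≤ |x| ∧ ⟨x, y⟩ ∈ G} ∈ NP^G` (`BGS.U`, `BGS.U_mem_NPRel`);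
* `BGS.isDense_forces_diagReq` — **the requirement is met by finite extension**: the conditions
  forcing `DiagReq D` are dense. This is the stage of the printed diagonalization (Arora–Barak,
  proof of Thm. 3.7, pp. 74–75), run from an arbitrary condition `τ` instead of the previous
  stage: take a fresh length `n` above the domain of `τ` with `q(n) < 2ⁿ` (`BGS.exists_lt_two_pow`),
  run `M` on `1ⁿ` for `q(n)` rounds with the undecided strings answered "no", and extend `τ` by the
  answers given, by "no" on all `⟨1ⁿ, y⟩`, `|y| ≤ n`, and — if the run rejected — by "yes" on one
  unqueried `⟨1ⁿ, y⟩`, `|y| = n` (`BGS.exists_unqueried`); by the locality of runs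
  (`QuantumComplexity.run_congr`) every oracle extending the new condition reproduces the run and
  makes it wrong;
* `BGS.diagFamily`, `BGS.diagFamily_countable` — the family of these forcing sets over all
  polynomial-time pairs is countable ("machines as strings", `BGS.exists_enum_pair`);
* `BGS.U_not_mem_PRel_of_isGeneric`, **`PRel_ne_NPRel_of_isGeneric`** — every
  `diagFamily`-generic `G` has `U_G ∉ P^G`, hence `P^G ≠ NP^G`; `cohenGeneric_PRel_ne_NPRel` — the
  `∃`-countable-family form used by the tree's genericity facts; and the density of separating
  oracles, `exists_extendedBy_PRel_ne_NPRel` (through every condition there is `G` with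
  `P^G ≠ NP^G`; at the empty condition this is again `∃ B, P^B ≠ NP^B`, obtained from
  `exists_extendedBy_isGeneric` without any stage bookkeeping — the modularity the toolkit
  advertises: "One no longer needs to worry about how to interleave requirements explicitly").

## References

* [FennerFortnowKurtzLi2003IC] §1 pp. 2–3 (requirements met by finite extension; "any Cohen
  generic oracle separates these two classes"), §4 p. 16 (Cohen conditions), read via
  `lit read doi:10.1016/s0890-5401(03)00018-x`.
* [AroraBarakCC2009] Thm. 3.7 and its proof, pp. 74–75 (`U_B`, the stage: fewer than `2ⁿ`
  queries, flip an unqueried string), as formalized in `BakerGillSolovay.lean`.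
* [FortnowRogers1999JCSS] §2.6 (arXiv numbering): requirements, "to make `P^X ≠ NP^X` … `Rᵢ` is
  the statement `L(Mᵢ^X) ≠ L(N^X)`. If we construct an oracle `X` satisfying every `Rᵢ` then
  `P^X ≠ NP^X`."
-/

namespace Literature.Computability.Complexity

open _root_.Computability Polynomial CohenCondition

namespace BGS

variable {G : Language Bool}

/-! ### The requirement of a (machine, polynomial) pair -/

/-- **The diagonalization requirement** `R_D` of the pair `D = (M, q)` against the oracle `G`:
on some input `x`, the run of `M` with oracle `G` for `q(|x|)` rounds does not output the bit
`[x ∈ U_G]` ("`Rᵢ` is the statement `L(Mᵢ^X) ≠ L(N^X)`", with `N` the `NP` machine of `U`).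
[cite: FortnowRogers1999JCSS, §2.6 (arXiv numbering)] [cite: AroraBarakCC2009, Thm. 3.7 (proof)] -/
def DiagReq (D : OracleAlg Bool × Polynomial ℕ) (G : Language Bool) : Prop :=
  ∃ x : List Bool, D.1.run (Oracle.ofLanguage G) (D.2.eval x.length) x ≠ some ((U G).boolIndicator x)

/-- If every polynomial-time pair meets its requirement then `U_G ∉ P^G`.
[cite: FortnowRogers1999JCSS, §2.6 (arXiv numbering)] -/
theorem U_not_mem_PRel_of_diagReq
    (h : ∀ D : OracleAlg Bool × Polynomial ℕ, D.1.IsPolyTime encodingBoolBool → DiagReq D G) :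
    U G ∉ PRel (Oracle.ofLanguage G) := by
  rintro ⟨M, hM, q, hq⟩
  obtain ⟨x, hx⟩ := h (M, q) hM
  exact hx (hq x).1

/-! ### Reading an oracle off a restriction condition -/

/-- An oracle extending `restrict A s` agrees with `A` on `s` (memberships as sets of strings,
the form in which `Oracle.ofLanguage_apply_eq_of_iff` and `BGS.U` consume them). [folklore] -/
theorem mem_iff_mem_of_extendedBy_restrict {A G : Set (List Bool)} {s : Finset (List Bool)}
    (h : (restrict A s).ExtendedBy G) {w : List Bool} (hw : w ∈ s) : w ∈ G ↔ w ∈ A :=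
  (h.mem_iff (val_restrict_of_mem hw)).trans (Set.mem_iff_boolIndicator _ _).symm

/-- The strings a condition makes true, as an oracle (undecided strings read as "no"); the
condition is extended by it. [cite: AroraBarakCC2009, Thm. 3.7 (proof: "the oracle built so far")] -/
theorem extendedBy_setOf_val_eq_true (τ : CohenCondition) :
    τ.ExtendedBy ({w | τ.val w = some true} : Set (List Bool)) := by
  intro w b hw
  change τ.val w = some true ↔ b = true
  rw [hw, Option.some.injEq]

/-- The lengths of the strings decided by a condition are bounded. [folklore] -/
theorem exists_length_le_of_mem_dom (τ : CohenCondition) : ∃ N : ℕ, ∀ w ∈ τ.dom, w.length ≤ N := by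
  obtain ⟨N, hN⟩ := (τ.dom_finite.image List.length).bddAbove
  exact ⟨N, fun w hw => hN (Set.mem_image_of_mem _ hw)⟩

/-! ### The requirement is met by finite extension -/

/-- **Density of the forcing sets** (the Baker–Gill–Solovay stage from an arbitrary condition):
for every pair `D = (M, q)` and every condition `τ` there is an extension of `τ` forcing the
requirement `R_D` — fresh length `n` above `dom τ` with `q(n) < 2ⁿ`; run `M` on `1ⁿ` with the
undecided strings answered "no"; freeze the answers and all `⟨1ⁿ, y⟩`, `|y| ≤ n`, as "no", and if
the run rejected put one unqueried `⟨1ⁿ, y⟩`, `|y| = n`, in. [cite: AroraBarakCC2009, Thm. 3.7 (proof, pp. 74–75)] [cite: FennerFortnowKurtzLi2003IC, §1 p. 3] -/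
theorem isDense_forces_diagReq (D : OracleAlg Bool × Polynomial ℕ) :
    IsDense {σ : CohenCondition | σ.Forces (DiagReq D)} := by
  classical
  intro τ
  obtain ⟨M, q⟩ := D
  -- the oracle of `τ` (undecided = no), a length bound for `dom τ`, a fresh length `n`
  set A₀ : Set (List Bool) := {w | τ.val w = some true} with hA₀
  have hτA₀ : τ.ExtendedBy A₀ := extendedBy_setOf_val_eq_true τ
  obtain ⟨N, hN⟩ := exists_length_le_of_mem_dom τ
  obtain ⟨n, hNn, hqn⟩ := exists_lt_two_pow q N
  have hfresh : ∀ y : List Bool, boolPair (ones n) y ∉ τ.dom := fun y hy => by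
    have := hN _ hy
    rw [length_boolPair, List.length_replicate] at this
    omega
  -- the run from `τ`'s oracle and its queries
  set k := q.eval n with hk
  set Q := M.queries (Oracle.ofLanguage A₀) k (ones n) with hQ
  have hQlen : Q.length < 2 ^ n := (M.length_queries_le _ _ _).trans_lt hqn
  -- the block of the witness strings `⟨1ⁿ, y⟩`, `|y| ≤ n`
  set Blk : Set (List Bool) := (fun y => boolPair (ones n) y) '' {y : List Bool | y.length ≤ n}
    with hBlk
  have hBlkfin : Blk.Finite := (List.finite_length_le Bool n).image _
  -- the finite set of strings to freeze
  set s : Finset (List Bool) := τ.dom_finite.toFinset ∪ Q.toFinset ∪ hBlkfin.toFinset with hs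
  have hdom_s : τ.dom ⊆ ↑s := fun w hw => by simp [hs, hw]
  have hQ_s : ∀ w ∈ Q, w ∈ s := fun w hw => by simp [hs, hw]
  have hBlk_s : ∀ y : List Bool, y.length ≤ n → boolPair (ones n) y ∈ s := fun y hy => by
    have : boolPair (ones n) y ∈ Blk := ⟨y, hy, rfl⟩
    simp [hs, this]
  by_cases hres : M.run (Oracle.ofLanguage A₀) k (ones n) = some false
  · -- rejected: put an unqueried `⟨1ⁿ, y⟩`, `|y| = n`, into the oracle
    obtain ⟨y, hy, hyQ⟩ := exists_unqueried (ones n) n Q hQlen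
    set A₁ : Set (List Bool) := insert (boolPair (ones n) y) A₀ with hA₁
    have hτA₁ : τ.ExtendedBy A₁ := by
      intro w b hw
      have hne : w ≠ boolPair (ones n) y := by
        rintro rfl
        exact hfresh y (by rw [mem_dom_iff, hw]; exact Option.some_ne_none b)
      refine Iff.trans (b := w ∈ A₁) Iff.rfl ?_
      rw [hA₁, Set.mem_insert_iff, or_iff_right hne]
      exact hτA₀ w b hw
    refine ⟨restrict A₁ s, ?_, le_restrict_of_extendedBy hτA₁ hdom_s⟩
    intro G hG
    refine ⟨ones n, ?_⟩
    have hrun : M.run (Oracle.ofLanguage G) k (ones n) = some false := by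
      rw [← hres]
      refine QuantumComplexity.run_congr M fun w hw => Oracle.ofLanguage_apply_eq_of_iff ?_
      rw [mem_iff_mem_of_extendedBy_restrict hG (hQ_s w hw), hA₁, Set.mem_insert_iff,
        or_iff_right]
      rintro rfl
      exact hyQ hw
    have hU : ones n ∈ U G := by
      refine ⟨y, by rw [hy, List.length_replicate], ?_⟩
      rw [mem_iff_mem_of_extendedBy_restrict hG (hBlk_s y hy.le), hA₁]
      exact Set.mem_insert _ _
    rw [List.length_replicate, ← hk, hrun, (Set.mem_iff_boolIndicator _ _).1 hU]
    simp
  · -- accepted (or no output): freeze everything as it is, no witness string ever enters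
    refine ⟨restrict A₀ s, ?_, le_restrict_of_extendedBy hτA₀ hdom_s⟩
    intro G hG
    refine ⟨ones n, ?_⟩
    have hrun : M.run (Oracle.ofLanguage G) k (ones n) = M.run (Oracle.ofLanguage A₀) k (ones n) :=
      QuantumComplexity.run_congr M fun w hw =>
        Oracle.ofLanguage_apply_eq_of_iff (mem_iff_mem_of_extendedBy_restrict hG (hQ_s w hw))
    have hU : ones n ∉ U G := by
      rintro ⟨y, hy, hyG⟩
      rw [List.length_replicate] at hy
      rw [mem_iff_mem_of_extendedBy_restrict hG (hBlk_s y hy)] at hyG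
      -- `⟨1ⁿ, y⟩ ∈ A₀` means `τ` decided it `true`, but it is fresh
      exact hfresh y (by rw [mem_dom_iff, show τ.val _ = some true from hyG]; exact Option.some_ne_none _)
    rw [List.length_replicate, ← hk, hrun, (Set.notMem_iff_boolIndicator _ _).1 hU]
    exact hres

/-! ### The countable family and the separation -/

/-- The family of forcing sets of the requirements of all polynomial-time pairs.
[cite: FennerFortnowKurtzLi2003IC, §1 p. 3] -/
def diagFamily : Set (Set CohenCondition) :=
  (fun D : OracleAlg Bool × Polynomial ℕ => {σ : CohenCondition | σ.Forces (DiagReq D)}) ''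
    {D | D.1.IsPolyTime encodingBoolBool}

/-- The family is countable (machines as strings: `exists_enum_pair`). [cite: AroraBarakCC2009, §1.4] -/
theorem diagFamily_countable : diagFamily.Countable := by
  obtain ⟨e, he⟩ := exists_enum_pair
  exact ((Set.countable_range e).mono he).image _

/-- Every member of the family is dense. [cite: AroraBarakCC2009, Thm. 3.7 (proof)] -/
theorem isDense_of_mem_diagFamily {S : Set CohenCondition} (hS : S ∈ diagFamily) : IsDense S := by
  obtain ⟨D, -, rfl⟩ := hS
  exact isDense_forces_diagReq D

/-- **A generic oracle for the family defeats every polynomial-time machine on `U_G`**: `U_G ∉ P^G`.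
[cite: FennerFortnowKurtzLi2003IC, §1 p. 3] [cite: AroraBarakCC2009, Thm. 3.7] -/
theorem U_not_mem_PRel_of_isGeneric (hG : IsGeneric diagFamily G) : U G ∉ PRel (Oracle.ofLanguage G) :=
  U_not_mem_PRel_of_diagReq fun D hD =>
    hG.of_forces_of_mem ⟨D, hD, rfl⟩ (isDense_forces_diagReq D) fun _ h => h

end BGS

/-- **Every Cohen generic oracle separates `P` from `NP`** (Fenner–Fortnow–Kurtz–Li: "any Cohen
generic oracle separates these two classes"): an oracle generic for the countable family
`BGS.diagFamily` of dense sets — in particular every oracle meeting all dense arithmetical sets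
of conditions — satisfies `P^G ≠ NP^G`, witnessed by `U_G ∈ NP^G ∖ P^G`.
[cite: FennerFortnowKurtzLi2003IC, §1 p. 3] [cite: AroraBarakCC2009, Thm. 3.7] -/
theorem PRel_ne_NPRel_of_isGeneric {G : Language Bool} (hG : IsGeneric BGS.diagFamily G) :
    PRel (Oracle.ofLanguage G) ≠ NPRel (Oracle.ofLanguage G) := fun heq =>
  BGS.U_not_mem_PRel_of_isGeneric hG (heq ▸ BGS.U_mem_NPRel G)

/-- Genericity for any larger family still separates. [cite: FennerFortnowKurtzLi2003IC, §1 p. 3] -/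
theorem PRel_ne_NPRel_of_isGeneric_of_subset {𝒮 : Set (Set CohenCondition)} (h𝒮 : BGS.diagFamily ⊆ 𝒮)
    {G : Language Bool} (hG : IsGeneric 𝒮 G) :
    PRel (Oracle.ofLanguage G) ≠ NPRel (Oracle.ofLanguage G) :=
  PRel_ne_NPRel_of_isGeneric (hG.anti h𝒮)

/-- The `∃`-countable-family form (the shape of the tree's genericity facts, e.g.
`Literature.Barriers.QuantumAdvantage.isInfinitePHRel_join_generic` at level `k = 0`, unjoined): there is
a countable family of sets of conditions every generic oracle for which separates `P` from `NP`.
[cite: FennerFortnowKurtzLi2003IC, §1 p. 3] -/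
theorem cohenGeneric_PRel_ne_NPRel :
    ∃ 𝒮 : Set (Set CohenCondition), 𝒮.Countable ∧
      ∀ G : Language Bool, IsGeneric 𝒮 G → PRel (Oracle.ofLanguage G) ≠ NPRel (Oracle.ofLanguage G) :=
  ⟨BGS.diagFamily, BGS.diagFamily_countable, fun _ hG => PRel_ne_NPRel_of_isGeneric hG⟩

/-- **Separating oracles are dense**: every Cohen condition is extended by an oracle `G` with
`P^G ≠ NP^G` (existence of generics through any condition, `exists_extendedBy_isGeneric`); at
`σ₀ = ⊥` this re-derives Baker–Gill–Solovay's `∃ B, P^B ≠ NP^B` (the tree's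
`exists_oracle_PRel_ne_NPRel`, `BakerGillSolovay.lean`) with no stage bookkeeping.
[cite: FennerFortnowKurtzLi2003IC, §1 p. 3 and Lemma 3.12] [cite: AroraBarakCC2009, Thm. 3.7] -/
theorem exists_extendedBy_PRel_ne_NPRel (σ₀ : CohenCondition) :
    ∃ G : Language Bool, σ₀.ExtendedBy G ∧ PRel (Oracle.ofLanguage G) ≠ NPRel (Oracle.ofLanguage G) := by
  obtain ⟨G, hσ₀, hG⟩ := exists_extendedBy_isGeneric BGS.diagFamily_countable σ₀
  exact ⟨G, hσ₀, PRel_ne_NPRel_of_isGeneric hG⟩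

end Literature.Computability.Complexity
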